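import Literature.Computation.Certificates.FacialReduction

/-!
# The low-rank (Burer–Monteiro) reformulation of a semidefinite program: feasibility, orthogonal
# invariance, the Lagrangian, and the a-posteriori optimality certificate (Burer–Monteiro 2003, §2)

Source: S. Burer, R. D. C. Monteiro, *A nonlinear programming algorithm for solving semidefinite programs
via low-rank factorization*, Math. Program. 95 (2003) 329–357 [BurerMonteiro2003], §2 "The nonlinear
formulation", pp. 332–336 (held text read: §2.1 (1)–(5), Thm 1; §2.2 (6)–(12), Props 2–4).

THE SETTING (their (1), (3), (N_r)). The standard primal SDP `min C • X s.t. Aᵢ • X = bᵢ (i ∈ ι), X ⪰ 0`,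
its dual `max bᵀy s.t. S = C − Σ yᵢ Aᵢ ⪰ 0`, and the LOW-RANK REFORMULATION obtained by the change of
variables `X = R Rᵀ`, `R ∈ ℝ^{n×r}`:
`(N_r)  min { C • (R Rᵀ) : Aᵢ • (R Rᵀ) = bᵢ, i ∈ ι }` —
"A slightly different perspective … instead of using a factorization that is valid for all feasible
solutions, use one that is valid for some or all optimal solutions" (p. 333). We reuse the primal/dual
vocabulary of `SemidefiniteComplementarity` (`frob M X = tr(M X)`, `IsPrimalFeasible`, `slack C A y =
C − Σ yᵢ Aᵢ`, `IsDualFeasible`, `gap`, and Lemma 2.12 = their Proposition 1), with the factor `R` indexed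
by an arbitrary finite type `ρ` of columns (so `r = |ρ|`).

WHAT IS PROVED (everything; no named fact, no definition beyond two abbreviations):

* §1 `factor R = R Rᵀ` is positive semidefinite, so a point of `(N_r)` is a primal feasible point
  (`isPrimalFeasible_factor`: the easy inclusion "(N_r) ⊆ (1)" of §2.1); conversely for `r = n` EVERY
  positive semidefinite `X` is `R Rᵀ` for a square `R` (`exists_factor_eq_of_posSemidef`; "when `r = n`, (2) is
  equivalent to (1) since the constraint `X = R Rᵀ` can be dropped", p. 331–332). (For `r(r+1)/2 ≤ m`-type
  statements — their Theorem 1, "proven concurrently in Barvinok [1] and Pataki [21]" — see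
  `Literature.Computation.Certificates.PatakiRankBound`.)
* §2 ORTHOGONAL INVARIANCE (p. 334–335): for `Q Qᵀ = 1`, `(RQ)(RQ)ᵀ = R Rᵀ`, hence `RQ` has the same
  constraint values and the same objective value as `R` (`factor_mul_of_orthogonal`,
  `isPrimalFeasible_factor_mul_iff`, `frob_factor_mul_of_orthogonal`) — the computation behind "(N_r) has
  no strict local minima".
* §3 THE LAGRANGIAN (their (6)–(9)): `L(R, y) = C • (RRᵀ) − Σ yᵢ (Aᵢ • (RRᵀ) − bᵢ) = S • (RRᵀ) + bᵀy`
  with `S = C − Σ yᵢAᵢ` (`lagrangian_eq_frob_slack_add`), and the exact second-order expansion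
  `S • ((R+D)(R+D)ᵀ) = S • (RRᵀ) + 2 (SR) •_F D + S • (DDᵀ)` for symmetric `S` (`frob_factor_add`), which is
  the content of "`∇_R L(R, y) = 2 S R`" ((9)): the linear term is the Frobenius pairing with `2 S R`
  (`frob_mul_transpose_eq_sum`).
* §4 **PROPOSITION 3** (p. 335), the a-posteriori OPTIMALITY CERTIFICATE for a factorized point: "Let `R*`
  be a stationary point of (N_r), i.e., there exists `y*` such that `∇_R L(R*, y*) = 0` [⟺ `S* R* = 0`]. If
  the associated matrix `S*` is positive semidefinite, then `X* = R*(R*)ᵀ` and `(S*, y*)` are optimal for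
  (1) and (3), respectively." — `optimal_of_stationary_of_slack_posSemidef` (with equal optimal values);
  proof as printed: `S* X* = S* R* R*ᵀ = 0` and Proposition 1 (= `lemma_2_12`). Also the trace form actually
  checked by a certificate reader after rounding: `S ⪰ 0` and `S • (RRᵀ) = 0` suffice
  (`optimal_of_frob_slack_factor_eq_zero`), and with `S • (RRᵀ) = ε` instead of `0` the pair is
  `ε`-optimal (`value_le_add_of_frob_slack_factor_eq`, weak duality bookkeeping).
* §5 the quadratic-form step of **Proposition 4** (p. 335): "`Ŝ • (DDᵀ) = Ŝ • (ddᵀ) = dᵀŜd ≥ 0`. Since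
  `d` is arbitrary, … `Ŝ` is positive semidefinite" — `posSemidef_of_forall_frob_vecMulVec_nonneg`.

* §6 (added): the a-posteriori GLOBAL optimality test for a low-rank stationary point that the landscape papers
  print as their starting point — a column-rank-deficient second-order critical point has `S ⪰ 0`
  (Journée–Bach–Absil–Sepulchre 2010 Thm. 7; Boumal–Voroninski–Bandeira 2020 Prop. 3.1, proof as printed:
  `Ẏ = x zᵀ` with `Yz = 0` is tangent and `⟨Ẏ, SẎ⟩ = ‖z‖² xᵀSx`) — `slack_posSemidef_of_secondOrder_of_mulVec_eq_zero`,
  `optimal_of_secondOrder_of_mulVec_eq_zero`.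

NOT HERE: the analytic halves of Props 2 and 4 (necessary conditions at a regular LOCAL minimum; the
rank-increment test) and §3–§4 of the paper (the augmented-Lagrangian algorithm, complexity Props 5–7);
the landscape theorems for (N_r) (Boumal–Voroninski–Bandeira 2020, Waldspurger–Waters 2020) are
statements about generic costs and are not certificate mathematics. USE: a low-rank (or learned, or
first-order) primal proposal `R` together with multipliers `y` is CERTIFIED optimal exactly by §4 —
feasibility of `RRᵀ`, `S ⪰ 0` (e.g. via `SemidefiniteRigorousBounds` after rounding), `S R = 0` or
`S • RRᵀ` small.
-/

namespace Literature.Computation.Certificates.BurerMonteiroOptimality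

open Matrix
open scoped BigOperators
open SemidefiniteComplementarity (frob IsPrimalFeasible slack IsDualFeasible gap frob_sub_left
  frob_sum_smul_left frob_nonneg_of_posSemidef weakDuality gap_eq_frob_slack lemma_2_12
  primalOptimal_of_gap_eq_zero dualOptimal_of_gap_eq_zero exists_eq_conjTranspose_mul_self)

variable {n : Type*} [Fintype n] [DecidableEq n] {ι : Type*} [Fintype ι]
variable {ρ : Type*} [Fintype ρ] [DecidableEq ρ]

/-! ## §1 The factorization `X = R Rᵀ` -/

/-- The low-rank variable of `(N_r)`: `X = R Rᵀ` for a rectangular `R ∈ ℝ^{n×r}` (columns indexed by `ρ`).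
[cite: BurerMonteiro2003, §1 eq. (2) and §2.1 (N_r)] -/
abbrev factor (R : Matrix n ρ ℝ) : Matrix n n ℝ := R * Rᵀ

omit [DecidableEq n] [DecidableEq ρ] in
/-- `R Rᵀ ⪰ 0`: the factorization builds positive semidefiniteness in. [cite: BurerMonteiro2003, §1 eq. (2)] -/
theorem posSemidef_factor (R : Matrix n ρ ℝ) : (factor R).PosSemidef := by
  simpa [factor, conjTranspose_eq_transpose_of_trivial] using posSemidef_self_mul_conjTranspose R

omit [DecidableEq n] [DecidableEq ρ] [Fintype ι] in
/-- A point of `(N_r)` is a feasible point of the SDP (1): "(N_r) … a subset of the SDP optimal solution set"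
is built on `{R Rᵀ : Aᵢ • (R Rᵀ) = bᵢ} ⊆ {X ⪰ 0 : Aᵢ • X = bᵢ}`. [cite: BurerMonteiro2003, §2.1 (1), (N_r)] -/
theorem isPrimalFeasible_factor {A : ι → Matrix n n ℝ} {b : ι → ℝ} {R : Matrix n ρ ℝ}
    (hR : ∀ i, frob (A i) (factor R) = b i) : IsPrimalFeasible A b (factor R) :=
  ⟨posSemidef_factor R, hR⟩

/-- For `r = n` the reformulation loses nothing: every `X ⪰ 0` is `R Rᵀ` with a SQUARE `R` ("when `r = n`,
(2) is equivalent to (1) since the constraint `X = V Vᵀ` … is valid for all feasible solutions").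
[cite: BurerMonteiro2003, §1 eq. (2)] -/
theorem exists_factor_eq_of_posSemidef {X : Matrix n n ℝ} (hX : X.PosSemidef) :
    ∃ R : Matrix n n ℝ, factor R = X := by
  obtain ⟨B, hB⟩ := exists_eq_conjTranspose_mul_self hX
  refine ⟨Bᵀ, ?_⟩
  simp only [factor, transpose_transpose]
  rw [hB, conjTranspose_eq_transpose_of_trivial]

/-! ## §2 Orthogonal invariance `R ↦ R Q` -/

omit [Fintype n] [DecidableEq n] in
/-- `(RQ)(RQ)ᵀ = R Q Qᵀ Rᵀ = R Rᵀ` for `Q Qᵀ = I`. [cite: BurerMonteiro2003, §2.2 display after Prop. 2 (p. 334)] -/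
theorem factor_mul_of_orthogonal (R : Matrix n ρ ℝ) {Q : Matrix ρ ρ ℝ} (hQ : Q * Qᵀ = 1) :
    factor (R * Q) = factor R := by
  simp only [factor, transpose_mul, Matrix.mul_assoc]
  rw [← Matrix.mul_assoc Q, hQ, Matrix.one_mul]

omit [DecidableEq n] [Fintype ι] in
/-- "Then the point `RQ` is also feasible": the constraint values of `RQ` and `R` agree, so feasibility for
`(N_r)` is invariant under right multiplication by an orthogonal matrix. [cite: BurerMonteiro2003, §2.2 (p. 334)] -/
theorem isPrimalFeasible_factor_mul_iff {A : ι → Matrix n n ℝ} {b : ι → ℝ} (R : Matrix n ρ ℝ)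
    {Q : Matrix ρ ρ ℝ} (hQ : Q * Qᵀ = 1) :
    IsPrimalFeasible A b (factor (R * Q)) ↔ IsPrimalFeasible A b (factor R) := by
  rw [factor_mul_of_orthogonal R hQ]

omit [Fintype n] [DecidableEq n] in
/-- "… and its objective value equals that of `R`": `C • ((RQ)(RQ)ᵀ) = C • (R Rᵀ)`.
[cite: BurerMonteiro2003, §2.2 (p. 334)] -/
theorem frob_factor_mul_of_orthogonal [Fintype n] (C : Matrix n n ℝ) (R : Matrix n ρ ℝ) {Q : Matrix ρ ρ ℝ}
    (hQ : Q * Qᵀ = 1) : frob C (factor (R * Q)) = frob C (factor R) := by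
  rw [factor_mul_of_orthogonal R hQ]

/-! ## §3 The Lagrangian of `(N_r)` and its quadratic expansion -/

/-- The Lagrangian of `(N_r)`: `L(R, y) = C • (RRᵀ) − Σᵢ yᵢ (Aᵢ • (RRᵀ) − bᵢ)` ((6)).
[cite: BurerMonteiro2003, §2.2 eq. (6)] -/
def lagrangian (C : Matrix n n ℝ) (A : ι → Matrix n n ℝ) (b : ι → ℝ) (R : Matrix n ρ ℝ) (y : ι → ℝ) : ℝ :=
  frob C (factor R) - ∑ i, y i * (frob (A i) (factor R) - b i)

omit [DecidableEq ρ] in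
/-- (7)–(8): `L(R, y) = S • (RRᵀ) + bᵀ y` with `S = C − Σ yᵢ Aᵢ`. [cite: BurerMonteiro2003, §2.2 eqs. (7)–(8)] -/
theorem lagrangian_eq_frob_slack_add (C : Matrix n n ℝ) (A : ι → Matrix n n ℝ) (b : ι → ℝ)
    (R : Matrix n ρ ℝ) (y : ι → ℝ) :
    lagrangian C A b R y = frob (slack C A y) (factor R) + ∑ i, b i * y i := by
  unfold lagrangian
  rw [slack, frob_sub_left, frob_sum_smul_left]
  simp only [mul_sub, Finset.sum_sub_distrib]
  have h : ∑ i, y i * b i = ∑ i, b i * y i := Finset.sum_congr rfl fun i _ => mul_comm _ _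
  rw [h]; ring

omit [DecidableEq n] [DecidableEq ρ] in
/-- The Frobenius pairing of the gradient with a direction, for symmetric `S`:
`S • (D Rᵀ) = Σ_{a,j} (S R)_{aj} D_{aj}`, i.e. `S • (D Rᵀ) = ⟨S R, D⟩_F` — the matrix `S R` of (9).
[cite: BurerMonteiro2003, §2.2 eq. (9)] -/
theorem frob_mul_transpose_eq_sum {S : Matrix n n ℝ} (hS : S.IsSymm) (R D : Matrix n ρ ℝ) :
    frob S (D * Rᵀ) = ∑ a, ∑ j, (S * R) a j * D a j := by
  conv_rhs => rw [← hS.eq]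
  simp only [frob, trace, diag_apply, mul_apply, transpose_apply]
  simp only [Finset.mul_sum, Finset.sum_mul]
  rw [Finset.sum_comm]
  refine Finset.sum_congr rfl fun a _ => ?_
  rw [Finset.sum_comm]
  refine Finset.sum_congr rfl fun j _ => Finset.sum_congr rfl fun k _ => ?_
  ring

omit [DecidableEq n] [DecidableEq ρ] in
/-- For symmetric `S`: `S • (R Dᵀ) = S • (D Rᵀ)` (cyclicity + transposition of the trace). [folklore] -/
private theorem frob_mul_transpose_comm {S : Matrix n n ℝ} (hS : S.IsSymm) (R D : Matrix n ρ ℝ) :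
    frob S (R * Dᵀ) = frob S (D * Rᵀ) := by
  unfold frob
  calc (S * (R * Dᵀ)).trace = ((S * (R * Dᵀ))ᵀ).trace := (trace_transpose _).symm
    _ = (D * Rᵀ * S).trace := by rw [transpose_mul, transpose_mul, transpose_transpose, hS.eq, Matrix.mul_assoc]
    _ = (S * (D * Rᵀ)).trace := trace_mul_comm _ _

omit [DecidableEq n] [DecidableEq ρ] in
/-- **Exact quadratic expansion of `R ↦ S • (R Rᵀ)`** for symmetric `S`:
`S • ((R+D)(R+D)ᵀ) = S • (RRᵀ) + 2·S • (DRᵀ) + S • (DDᵀ)`; with `frob_mul_transpose_eq_sum` the linear term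
is `⟨2 S R, D⟩_F`, which is (9) "`∇_R L(R, y) = 2 S R`", and the quadratic term is the Hessian form of (11).
[cite: BurerMonteiro2003, §2.2 eqs. (9), (11)] -/
theorem frob_factor_add {S : Matrix n n ℝ} (hS : S.IsSymm) (R D : Matrix n ρ ℝ) :
    frob S (factor (R + D)) = frob S (factor R) + 2 * frob S (D * Rᵀ) + frob S (factor D) := by
  have h1 : factor (R + D) = factor R + (R * Dᵀ + D * Rᵀ) + factor D := by
    simp only [factor, transpose_add, Matrix.add_mul, Matrix.mul_add]; abel
  simp only [h1, frob, Matrix.mul_add, trace_add]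
  have h2 := frob_mul_transpose_comm hS R D
  unfold frob at h2
  rw [h2]; ring

/-! ## §4 Proposition 3: the optimality certificate for a factorized point -/

/-- `R` is a STATIONARY point of `(N_r)` with multiplier `y`: `∇_R L(R, y) = 2 S R = 0`, i.e. `S R = 0` with
`S = C − Σ yᵢ Aᵢ` ((9)–(10)). [cite: BurerMonteiro2003, §2.2 eqs. (9)–(10), Prop. 3] -/
def IsStationary (C : Matrix n n ℝ) (A : ι → Matrix n n ℝ) (R : Matrix n ρ ℝ) (y : ι → ℝ) : Prop :=
  slack C A y * R = 0

omit [DecidableEq n] [DecidableEq ρ] in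
/-- At a stationary point the complementarity `S X = 0` holds for `X = R Rᵀ`: "the condition `∇_R L(R*, y*) = 0`
can be rewritten as `S* R* = 0` … From this we easily [see] that `S* R* (R*)ᵀ = S* X* = 0`."
[cite: BurerMonteiro2003, §2.2 proof of Prop. 3] -/
theorem slack_mul_factor_eq_zero {C : Matrix n n ℝ} {A : ι → Matrix n n ℝ} {R : Matrix n ρ ℝ} {y : ι → ℝ}
    (hst : IsStationary C A R y) : slack C A y * factor R = 0 := by
  unfold IsStationary at hst
  simp only [factor, ← Matrix.mul_assoc, hst, Matrix.zero_mul]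

omit [DecidableEq ρ] in
/-- **Proposition 3 (Burer–Monteiro 2003).** "Let `R*` be a stationary point of (N_r), i.e., there exists `y*`
such that `∇_R L(R*, y*) = 0`. If the associated matrix `S*` is positive semidefinite, then `X* = R*(R*)ᵀ` and
`(S*, y*)` are optimal for (1) and (3), respectively" — and the optimal values agree, `C • X* = bᵀ y*`. Proof
as printed: `X*` is feasible for (1), `S*` for (3), `S* X* = S* R* R*ᵀ = 0`, and Proposition 1 (the tree's
`lemma_2_12`). [cite: BurerMonteiro2003, §2.2 Prop. 3] -/
theorem optimal_of_stationary_of_slack_posSemidef {C : Matrix n n ℝ} {A : ι → Matrix n n ℝ} {b : ι → ℝ}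
    {R : Matrix n ρ ℝ} {y : ι → ℝ} (hR : ∀ i, frob (A i) (factor R) = b i)
    (hst : IsStationary C A R y) (hS : (slack C A y).PosSemidef) :
    (∀ X', IsPrimalFeasible A b X' → frob C (factor R) ≤ frob C X') ∧
      (∀ y', IsDualFeasible C A y' → ∑ i, b i * y' i ≤ ∑ i, b i * y i) ∧
      frob C (factor R) = ∑ i, b i * y i :=
  lemma_2_12 (isPrimalFeasible_factor hR) hS (slack_mul_factor_eq_zero hst)

omit [DecidableEq ρ] in
/-- The TRACE form a certificate reader checks: feasibility of `R Rᵀ`, `S ⪰ 0` and `S • (R Rᵀ) = 0` already give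
optimality with equal values (the gap identity (2.8): `C • X − bᵀy = S • X`). [cite: BurerMonteiro2003, §2.2 Prop. 3;
eqs. (7)–(8)] -/
theorem optimal_of_frob_slack_factor_eq_zero {C : Matrix n n ℝ} {A : ι → Matrix n n ℝ} {b : ι → ℝ}
    {R : Matrix n ρ ℝ} {y : ι → ℝ} (hR : ∀ i, frob (A i) (factor R) = b i)
    (hS : (slack C A y).PosSemidef) (h0 : frob (slack C A y) (factor R) = 0) :
    (∀ X', IsPrimalFeasible A b X' → frob C (factor R) ≤ frob C X') ∧
      (∀ y', IsDualFeasible C A y' → ∑ i, b i * y' i ≤ ∑ i, b i * y i) ∧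
      frob C (factor R) = ∑ i, b i * y i := by
  have hg : gap C b (factor R) y = 0 := by rw [gap_eq_frob_slack hR, h0]
  exact ⟨fun X' hX' => primalOptimal_of_gap_eq_zero hS hg hX',
    fun y' hy' => dualOptimal_of_gap_eq_zero (isPrimalFeasible_factor hR) hg hy',
    sub_eq_zero.mp hg⟩

omit [DecidableEq ρ] in
/-- `ε`-version (what an inexact first-order / learned proposal delivers): if `R Rᵀ` is feasible, `S ⪰ 0` and
`S • (R Rᵀ) = ε`, then `C • (RRᵀ) = bᵀy + ε` and hence `C • (RRᵀ) ≤ C • X' + ε` for every feasible `X'` — the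
proposal is `ε`-optimal and `bᵀ y` is a certified lower bound on the SDP value (weak duality (2.8)).
[cite: BurerMonteiro2003, §2.2 eqs. (7)–(8), Prop. 1] -/
theorem value_le_add_of_frob_slack_factor_eq {C : Matrix n n ℝ} {A : ι → Matrix n n ℝ} {b : ι → ℝ}
    {R : Matrix n ρ ℝ} {y : ι → ℝ} {ε : ℝ} (hR : ∀ i, frob (A i) (factor R) = b i)
    (hS : (slack C A y).PosSemidef) (hε : frob (slack C A y) (factor R) = ε) :
    frob C (factor R) = ∑ i, b i * y i + ε ∧
      ∀ X', IsPrimalFeasible A b X' → frob C (factor R) ≤ frob C X' + ε := by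
  have hg : gap C b (factor R) y = ε := by rw [gap_eq_frob_slack hR, hε]
  have hval : frob C (factor R) = ∑ i, b i * y i + ε := by
    unfold gap at hg; linarith
  refine ⟨hval, fun X' hX' => ?_⟩
  have hw := weakDuality hX' hS
  linarith

/-! ## §5 The quadratic-form step of Proposition 4 -/

omit [DecidableEq n] in
/-- "`Ŝ • (DDᵀ) = Ŝ • (ddᵀ) = dᵀŜd ≥ 0`. Since `d` is arbitrary, the above inequality proves that `Ŝ` is positive
semidefinite": a symmetric `S` with `S • (d dᵀ) ≥ 0` for all `d` is positive semidefinite (`S • (ddᵀ) = dᵀ S d` is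
the tree's `FacialReduction.frob_vecMulVec`). [cite: BurerMonteiro2003, §2.2 proof of Prop. 4] -/
theorem posSemidef_of_forall_frob_vecMulVec_nonneg {S : Matrix n n ℝ} (hS : S.IsHermitian)
    (h : ∀ d : n → ℝ, 0 ≤ frob S (vecMulVec d d)) : S.PosSemidef := by
  refine Matrix.PosSemidef.of_dotProduct_mulVec_nonneg hS fun d => ?_
  simpa [FacialReduction.frob_vecMulVec] using h d

/-! ## §6 Rank-deficient second-order critical points are optimal
(Journée–Bach–Absil–Sepulchre 2010 Thm. 7 = arXiv Thm. 6; Boumal–Voroninski–Bandeira 2020 Prop. 3.1) -/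

omit [DecidableEq n] [DecidableEq ρ] in
/-- **A column-rank-deficient second-order critical point has `S ⪰ 0`.** "Let `Y` be a second-order critical
point for (P). If `rank(Y) < p`, then `S(Y) ⪰ 0` so that `Y` is globally optimal for (P) and so is `X = YYᵀ` for
(SDP)." Proof as printed: "Since `rank(Y) < p`, there exists `z ∈ ℝᵖ` such that `z ≠ 0` and `Yz = 0`. Furthermore,
for all `x ∈ ℝⁿ`, the matrix `Ẏ = x zᵀ` is such that `Y Ẏᵀ = 0`. In particular, `Ẏ` is a tangent vector at `Y`.
Since `Y` is second-order critical, […] `0 ≤ ⟨Ẏ, S Ẏ⟩ = ‖z‖² · xᵀ S x`. This holds for all `x`. Thus, `S` is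
positive semidefinite." Here the second-order condition is taken in the elementary form in which it is USED — the
Hessian quadratic form `⟨D, S D⟩ = S • (D Dᵀ)` of the Lagrangian (`frob_factor_add`) is nonnegative along every
direction `D` tangent to the constraints, `Aᵢ • (D Rᵀ + R Dᵀ) = 0` — for ANY multipliers `y` (the printed `S(Y)`
uses the least-squares multipliers; the argument does not), and column-rank deficiency as `R z = 0`, `z ≠ 0`.
[cite: BoumalVoroninskiBandeira2019, §3 Prop. 3.1 (arXiv:1804.02008 numbering)]
[cite: JourneeEtAl2010, Thm. 7 (= arXiv:0807.4423 Thm. 6)] -/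
theorem slack_posSemidef_of_secondOrder_of_mulVec_eq_zero {C : Matrix n n ℝ} {A : ι → Matrix n n ℝ}
    {R : Matrix n ρ ℝ} {y : ι → ℝ} (hsym : (slack C A y).IsSymm)
    (h2 : ∀ D : Matrix n ρ ℝ, (∀ i, frob (A i) (D * Rᵀ + R * Dᵀ) = 0) →
      0 ≤ frob (slack C A y) (D * Dᵀ))
    {z : ρ → ℝ} (hz : z ≠ 0) (hRz : R *ᵥ z = 0) : (slack C A y).PosSemidef := by
  refine posSemidef_of_forall_frob_vecMulVec_nonneg (Matrix.isHermitian_iff_isSymm.mpr hsym) fun d => ?_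
  have hzz : 0 < z ⬝ᵥ z := by
    refine lt_of_le_of_ne (by simpa using dotProduct_star_self_nonneg z) (fun h => hz ?_)
    exact dotProduct_self_eq_zero.mp h.symm
  -- the tangent direction `D = d zᵀ`
  have htan : ∀ i, frob (A i) (vecMulVec d z * Rᵀ + R * (vecMulVec d z)ᵀ) = 0 := by
    intro i
    rw [vecMulVec_mul, vecMul_transpose, hRz, vecMulVec_zero, transpose_vecMulVec, mul_vecMulVec, hRz,
      zero_vecMulVec, add_zero]
    simp [frob]
  have hD := h2 (vecMulVec d z) htan
  -- `D Dᵀ = ‖z‖² d dᵀ`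
  rw [transpose_vecMulVec, vecMulVec_mul_vecMulVec, vecMulVec_smul, frob, Matrix.mul_smul, trace_smul,
    smul_eq_mul] at hD
  exact (mul_nonneg_iff_of_pos_left hzz).mp hD

omit [DecidableEq ρ] in
/-- Consequently (the conclusion of the printed statement): a feasible, stationary (`S R = 0`), column-rank-deficient
point satisfying the second-order condition is GLOBALLY optimal — `R Rᵀ` solves the SDP, `y` solves its dual, with
equal values. [cite: BoumalVoroninskiBandeira2019, §3 Prop. 3.1 (arXiv:1804.02008 numbering)]
[cite: JourneeEtAl2010, Thm. 7 (= arXiv:0807.4423 Thm. 6)] -/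
theorem optimal_of_secondOrder_of_mulVec_eq_zero {C : Matrix n n ℝ} {A : ι → Matrix n n ℝ} {b : ι → ℝ}
    {R : Matrix n ρ ℝ} {y : ι → ℝ} (hR : ∀ i, frob (A i) (factor R) = b i) (hst : IsStationary C A R y)
    (hsym : (slack C A y).IsSymm)
    (h2 : ∀ D : Matrix n ρ ℝ, (∀ i, frob (A i) (D * Rᵀ + R * Dᵀ) = 0) →
      0 ≤ frob (slack C A y) (D * Dᵀ))
    {z : ρ → ℝ} (hz : z ≠ 0) (hRz : R *ᵥ z = 0) :
    (∀ X', IsPrimalFeasible A b X' → frob C (factor R) ≤ frob C X') ∧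
      (∀ y', IsDualFeasible C A y' → ∑ i, b i * y' i ≤ ∑ i, b i * y i) ∧
      frob C (factor R) = ∑ i, b i * y i :=
  optimal_of_stationary_of_slack_posSemidef hR hst
    (slack_posSemidef_of_secondOrder_of_mulVec_eq_zero hsym h2 hz hRz)

end Literature.Computation.Certificates.BurerMonteiroOptimality
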